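import Summits.QuantumFields.YangMills.Theorems.WeakCouplingRatesColdBoxExponents
import Summits.QuantumFields.YangMills.Theorems.ColdBoxAllGroupsBoxFloorAllGroupsChartWindowG

set_option autoImplicit false

noncomputable section

open Real Filter Topology

namespace Summit.QuantumFields.YangMills.Theorems.ColdBoxAllGroups

/-- **B9c «ExponentsG» (WANTED — statement fixed by the lead; pure real analysis, no measure theory).**  The one-scale window of the
`G`-generic expansion at `ε = 3θ`, link radius `m = 2η_β`, Gaussian radius `R = β^{3θ}/(2(√D+1))`, and the final smallness
`RHS(β) ≤ β^{−9θ}` of brick B9a «CoreG», hold eventually in `β` for every `0 < θ ≤ 1/100` and all constants `N, D, r₂, C₂`. -/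
theorem eventually_oneScale_boundsG (N D : ℕ) {θ r₂ C₂ : ℝ} (hθ : 0 < θ) (hθ1 : θ ≤ 1 / 100) (hr₂ : 0 < r₂) (hC₂ : 0 < C₂) :
    ∀ᶠ β : ℝ in atTop, 1 ≤ β ∧
      -- (2) link radius m = 2η ≤ 1/4 and ≤ r₂, and C₂ m² ≤ 1/2
      2 * ((12 * (⌈β ^ θ⌉₊ : ℝ) ^ 2 + 2 * ⌈β ^ θ⌉₊ + 1) * (Real.sqrt 2 * Real.sqrt (β ^ (2 * (3 * θ) - 1)))) ≤ 1 / 4 ∧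
      2 * ((12 * (⌈β ^ θ⌉₊ : ℝ) ^ 2 + 2 * ⌈β ^ θ⌉₊ + 1) * (Real.sqrt 2 * Real.sqrt (β ^ (2 * (3 * θ) - 1)))) ≤ r₂ ∧
      -- (3) Gaussian link radius mE ≤ m
      Real.sqrt D * ((12 * (⌈β ^ θ⌉₊ : ℝ) ^ 2 + 2 * ⌈β ^ θ⌉₊ + 1) * (β ^ (3 * θ) / (2 * (Real.sqrt D + 1)))) / Real.sqrt β ≤
        2 * ((12 * (⌈β ^ θ⌉₊ : ℝ) ^ 2 + 2 * ⌈β ^ θ⌉₊ + 1) * (Real.sqrt 2 * Real.sqrt (β ^ (2 * (3 * θ) - 1)))) ∧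
      -- (4) Gaussian window
      (D : ℝ) / 2 * (β ^ (3 * θ) / (2 * (Real.sqrt D + 1))) ^ 2 / β +
          190 * (Real.sqrt D * ((12 * (⌈β ^ θ⌉₊ : ℝ) ^ 2 + 2 * ⌈β ^ θ⌉₊ + 1) * (β ^ (3 * θ) / (2 * (Real.sqrt D + 1)))) / Real.sqrt β) ^ 3 <
        β ^ (2 * (3 * θ) - 1) ∧
      -- (5) Gaussian bad mass p < 1
      240 * (D : ℝ) * (2 * (⌈β ^ θ⌉₊ : ℝ) + 1) ^ 4 * Real.exp (-(β ^ (3 * θ) / (2 * (Real.sqrt D + 1))) ^ 2 / 2) < 1 ∧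
      -- (6) the final bound of CoreG with w replaced by its card upper bound is ≤ β^{-9θ}
      β ^ 2 * (24 * (N : ℝ) ^ 2 * Real.exp (-(β ^ (3 * θ)))) +
          3 * (β ^ (2 * (3 * θ))) ^ 2 * (Real.exp (2 * ((120 * (2 * (⌈β ^ θ⌉₊ : ℝ) + 1) ^ 4) *
              (190 * β * (2 * ((12 * (⌈β ^ θ⌉₊ : ℝ) ^ 2 + 2 * ⌈β ^ θ⌉₊ + 1) * (Real.sqrt 2 * Real.sqrt (β ^ (2 * (3 * θ) - 1))))) ^ 3) +
            (4 * (2 * (⌈β ^ θ⌉₊ : ℝ) + 1) ^ 4) *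
              (2 * C₂ * (2 * ((12 * (⌈β ^ θ⌉₊ : ℝ) ^ 2 + 2 * ⌈β ^ θ⌉₊ + 1) * (Real.sqrt 2 * Real.sqrt (β ^ (2 * (3 * θ) - 1))))) ^ 2))) - 1) +
          6 * (β ^ (2 * (3 * θ))) ^ 2 * (240 * (D : ℝ) * (2 * (⌈β ^ θ⌉₊ : ℝ) + 1) ^ 4 * Real.exp (-(β ^ (3 * θ) / (2 * (Real.sqrt D + 1))) ^ 2 / 2)) +
          2 * (190 * β * (2 * ((12 * (⌈β ^ θ⌉₊ : ℝ) ^ 2 + 2 * ⌈β ^ θ⌉₊ + 1) * (Real.sqrt 2 * Real.sqrt (β ^ (2 * (3 * θ) - 1))))) ^ 3) *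
            (β ^ (2 * (3 * θ)) + D) +
          Real.sqrt (240 * (D : ℝ) * (2 * (⌈β ^ θ⌉₊ : ℝ) + 1) ^ 4 * Real.exp (-(β ^ (3 * θ) / (2 * (Real.sqrt D + 1))) ^ 2 / 2)) *
            (2 * β ^ (2 * (3 * θ)) * D + 3 * (D : ℝ) ^ 2 + (D : ℝ) ^ 2) ≤
        β ^ (-(9 * θ)) := by
  sorry

end Summit.QuantumFields.YangMills.Theorems.ColdBoxAllGroups

end
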